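import Literature.AlgebraicGeometry.Milne1999.LefschetzCentraliser
import Literature.AlgebraicGeometry.Deligne1982.HodgeGroupInvariantClasses
import Literature.AlgebraicGeometry.HodgeTheory.DivisorClassesHardLefschetz
import Literature.AlgebraicGeometry.HodgeTheory.EllipticCurvesProductsHodgeConjecture
import Literature.AlgebraicGeometry.HodgeTheory.HodgeClassesIsogenyInvariance
import Literature.AlgebraicGeometry.HodgeTheory.HodgeConjectureAbelianSubquotients
import HarnessLib

/-!
# Milne 1999, Prop. 3.3 / Cor. 4.5 through the Hodge group: the `S(A)`-invariants are Hodge classes,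
# hence Lefschetz classes wherever `B = D` (every complex abelian variety in degree `2`, in dimension `≤ 3`,
# isogenous to a product of elliptic curves, …)

Family `hodge`, layer `Literature/AlgebraicGeometry/Milne1999`, namespace
`Literature.AlgebraicGeometry.Milne1999` (D-0022). THEOREMS ONLY (no definition, no named fact, D-0026; net
debt 0). Written for the cell `pub-hodgecm2` (COR-CM), seat `lit-milne` (gen 45), binder table
`HOME/lit/milne.md` rows M2/M4. Sequel of `Milne1999/SpecialLefschetzGroupInvariantsCommutativeEnd` (the
record PROVED for commutative `End(A)`) and `Milne1999/SpecialLefschetzGroupInvariantsCMType` (every `A` of CM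
type) on a locus transverse to both: **every complex abelian variety whose Hodge ring is generated by divisor
classes** (`HodgeTheory.IsDivisorGenerated A`, van Geemen's `B(A) = D(A)`), whatever `End(A)`.

## Source, verbatim (held text `paper:doi-10-1215-s0012-7094-99-09620-5` = J. S. Milne, *Lefschetz classes on abelian varieties*, Duke Math. J. 96 (1999) 639–675; PDF page = printed page − 638)

* §3, p. 653 (p0015 L22–L27): "**Theorem 3.2.** For any abelian variety `A` over `Ω` and integer `r ≥ 0`,
  the `k`-algebra `H*(A^r)^{S(A)}` is generated by divisor classes. This will be a consequence of the
  following two propositions. **Proposition 3.3.** For any abelian variety `A` over `Ω` and integer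
  `r ≥ 0`, the `k`-vector space `H²(A^r)^{S(A)}` is generated by divisor classes."
* §3, p. 653 (p0015 L33–L40), proof of 3.3: "We have to show that the space of skew-symmetric forms
  `ψ : V(A) × V(A) → k(1)` invariant under the action of `S(A)` […] is generated by the forms `e_D` with `D`
  a divisor on `A`. […] The next lemma shows that the `k`-algebra `C(A)` is generated by the
  `γ ∈ S(A)(k)`, and so Proposition 3.3 follows from Proposition 1.3." (Lemma 3.5: a semisimple algebra
  with involution over an algebraically closed field is generated by its unitary elements; Prop. 1.3 /
  Remark 1.2: double centraliser and Mumford p. 208.)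
* §4, p. 659 (p0021 L24–L26): "**Corollary 4.5.** For any abelian variety `A` and any `r ≥ 0`,
  `H^{2*}(A^r)(*)^{L(A)} = D_hom(A^r)_k`."; p. 659 (L28–L30): "the kernel of `l(A)` […] equals `S(A)`.";
  p. 660 (p0022 L33–L35): "Clearly `D_hom(A) ⊂ H(A)`, and so `L(A) ⊃ Hg(A)`."; Prop. 4.8 (p. 660): "(a) no
  power of `A` supports an exotic Hodge class; (b) `Hg(A) = L(A)`; (c) `Hg′(A) = S(A)`."
* P. Deligne, *Hodge cycles on abelian varieties*, LNM 900 (1982), I Prop. 3.4 (re-ed. p. 24): the rational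
  tensors fixed by the special Mumford–Tate group are exactly the Hodge classes of type `(0,0)` — the tree's
  theorem `Deligne1982.mem_span_hodgeClasses_of_forall_hodgeGroup_apply_eq` on the carriers:
  `(H²ᵖ(X(ℂ); ℂ))^{Hg(X)(ℂ)} = Bᵖ(X) ⊗ ℂ`.

## What is proved (complex Betti cohomology, the tree's carriers; all hypotheses displayed)

Write `S = specialLefschetzGroup n X` (Milne's `S(A)(ℂ) = ker l(A)(ℂ)`, `Milne1999/LefschetzGroup`),
`Hg = hodgeGroup n X`, `Bᵖ ⊗ ℂ = VanGeemen1994.hodgeClassSpan n X p` (the `ℂ`-span of the rational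
`(p,p)`-classes), `Dᵖ ⊗ ℂ = divisorClassesSpan X n p`.

* `mem_hodgeClassSpan_of_forall_specialLefschetzGroup_apply_eq` — **the `S`-invariants of `H²ᵖ(X(ℂ); ℂ)`
  lie in `Bᵖ ⊗ ℂ`**, for every smooth projective `X`: `Hg ≤ S` ("`L(A) ⊃ Hg(A)`", the tree's
  `hodgeGroup_le_specialLefschetzGroup`) and Deligne I 3.4 (tree). In odd degree only `0` is `S`-invariant
  (`eq_zero_of_forall_specialLefschetzGroup_apply_eq_of_odd`; Milne p. 657: "`−1` acts as `(−1)ⁱ` on `Hⁱ`").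
* `specialLefschetzGroup_invariants_le_of_hodgeClasses_divisorial` — hence **the conclusion of the cited
  record `Milne1999_specialLefschetzGroup_invariants_le` holds in every degree `2p` in which `Bᵖ ⊆ Dᵖ ⊗ ℂ`**;
  for abelian varieties: `specialLefschetzGroup_invariants_le_of_isDivisorGenerated` (**the record for every
  `A` with `B(A) = D(A)`**), with the Cor. 4.5 set form and the record-free closure of this locus under
  isogeny, abelian subvarieties and quotients (the tree's `IsDivisorGenerated.of_isIsogenous /
  of_isClosedImmersion / of_surjective_hom`).
* **Prop. 3.3 (`r = 1`) for EVERY complex abelian variety**: `specialLefschetzGroup_invariants_le_one`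
  (`H²(A(ℂ); ℂ)^{S(A)} ⊆ D¹(A) ⊗ ℂ`), and `setOf_forall_apply_eq_self_two_eq_hodgeClassSpan_one`
  (`H²(A)^{S(A)} = D¹ ⊗ ℂ = B¹ ⊗ ℂ = H²(A)^{Hg(A)}`; `divisorClassesSpan_one_eq_hodgeClassSpan_one`).
* **The record in the degrees `p ≤ 1` and `p + 1 ≥ dim`, for EVERY complex abelian variety**
  (`specialLefschetzGroup_invariants_le_of_le_one_or_dim_le_succ`; hard Lefschetz on the rational
  `(p,p)`-classes, the tree's `hodgeClasses_divisorial_of_le_one_or_le_succ`), hence **for every complex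
  abelian variety of dimension `≤ 3`** (`…_of_dim_le_three`: all Albert types, e.g. QM abelian surfaces,
  `E × E′`, `E³`), and for `dim A ≤ 5` (resp. `≤ 7`) as soon as `B² ⊆ D² ⊗ ℂ` (resp. and `B³ ⊆ D³ ⊗ ℂ`).
* **The record for every abelian variety isogenous to a product of powers of arbitrary elliptic curves**
  (`…_of_isIsogenous_multiPowSucc`; van Geemen Thm. 4.3 / Tate–Imai–Murasaki, the tree's
  `vanGeemen1994_thm43_isDivisorGenerated`), and for its abelian subvarieties and quotients — a locus with
  NON-commutative `End⁰(A) = ∏ M_{nᵢ}(ℚ or Kᵢ)`, in general not of CM type.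
* The `S(A)(ℂ)`-form read on `H¹` (`unitaryCentralizerGroup A h`, `⋀^{2p}u`) of all of the above, for ANY
  `h ∈ B¹(A) ⊗ ℂ` — no Kähler / non-degeneracy hypothesis (`mem_hodgeClassSpan_of_forall_exteriorPullback_eq`,
  `mem_divisorClassesSpan_of_forall_exteriorPullback_eq_of_isDivisorGenerated`): `Hg(A)(ℂ)|_{H¹} ≤ S(A)(ℂ)`
  (`hodgeGroupOne_le_unitaryCentralizerGroup`) and `g_q = ⋀^q g₁` on an abelian variety
  (`hodgeGroup_apply_cupPowOne`).

UPSHOT for the record (`r = 1`): after this file, `Milne1999/SpecialLefschetzGroupInvariantsCommutativeEnd`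
and `Milne1999/SpecialLefschetzGroupInvariantsCMType`, the cited record `Milne1999_specialLefschetzGroup_invariants_le`
asserts something not yet a tree theorem ONLY for complex abelian varieties `A` with non-commutative
`End(A)`, not of CM type, and carrying an exotic Hodge class on `A` itself (`B(A) ≠ D(A)`; e.g. simple
type III, Milne Remark 4.9 / Murty) — the `S(A)`-invariant exotic Hodge classes are what Thm. 3.2's
invariant theory (Prop. 3.6 (b), and (a), (c) with multiplicity) decides.

NOT Milne's road for Prop. 3.3: Milne proves 3.3 from Lemma 3.5 (unitary generation of `C(A)`) and
Prop. 1.3 (Remark 1.2 + Mumford p. 208); here the degree-`2` statement — and the whole `B = D` locus — comes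
from "`L(A) ⊃ Hg(A)`" (p. 660) and Deligne I Prop. 3.4, both tree theorems; Lemma 3.5 is not formalised.
NOT here: Thm. 3.2 / Prop. 3.6 (first fundamental theorem for `Sp`, `O`, `GL`), the record off the `B = D`
locus, the record on the powers `A^r` beyond what `IsDivisorGenerated (A^r)` gives instance-wise.

## References

* [Milne1999LefschetzClasses] J. S. Milne, Lefschetz classes on abelian varieties, Duke Math. J. 96 (1999)
  639–675: Thm. 3.2, Prop. 3.3 and its proof, Lemma 3.5 (p. 653), p. 657, Thm. 4.4, Cor. 4.5, p. 659
  (`ker l(A) = S(A)`), p. 660 (`L(A) ⊃ Hg(A)`), Prop. 4.8, Remark 4.9.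
* [Deligne1982HodgeCycles] P. Deligne, Hodge cycles on abelian varieties, LNM 900 (1982), I §3 Prop. 3.4.
* [MoonenZarhin1999LowDim] B. Moonen, Yu. Zarhin, Hodge classes on abelian varieties of low dimension,
  Math. Ann. 315 (1999) 711–733, Introduction (p. 711).
* [vanGeemen1994HodgeAV] B. van Geemen, An introduction to the Hodge conjecture for abelian varieties,
  LNM 1594 (1994), §2.4–2.5, Thm. 4.3, 6.5–6.7.
* [VoisinHodgeI2002] C. Voisin, Hodge Theory and Complex Algebraic Geometry I, Thm. 6.25, Rem. 6.27, §7.1.2.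
-/

noncomputable section

open CategoryTheory
open Literature.AlgebraicTopology.SingularHomology
open Literature.AlgebraicGeometry.HodgeTheory
open Literature.AlgebraicGeometry.Motives
open Literature.AlgebraicGeometry.VanGeemen1994 (hodgeClassSpan hodgeGroupOne mem_hodgeGroupOne_iff)
open Literature.Barriers.HodgeConjecture (divisorClassesSpan divisorMonomials mem_divisorMonomials_succ
  mem_divisorMonomials_zero)

namespace Literature.AlgebraicGeometry.Milne1999

/-! ### §1 Smooth projective `X`: the `S`-invariants are Hodge classes -/

section SmoothProjective

variable {n : ℕ} {X : SchemeOver ℂ}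

/-- **The `S`-invariants of `H²ᵖ(X(ℂ); ℂ)` lie in `Bᵖ(X) ⊗ ℂ`** — for every smooth projective complex `X`,
a class fixed by every element of `specialLefschetzGroup n X` (the Künneth families fixing all Lefschetz
classes on all powers; Milne's `S(A)(ℂ) = ker l(A)(ℂ)`) is a `ℂ`-combination of RATIONAL classes of Hodge
type `(p,p)`: it is fixed by the Hodge group, `Hg ≤ S` ("`L(A) ⊃ Hg(A)`", p. 660; the tree's
`hodgeGroup_le_specialLefschetzGroup`), whose invariants are `Bᵖ ⊗ ℂ` (Deligne I Prop. 3.4, the tree's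
`Deligne1982.mem_span_hodgeClasses_of_forall_hodgeGroup_apply_eq`).
[cite: Milne1999LefschetzClasses, §4 p. 660 (`L(A) ⊃ Hg(A)`) and p. 659 (`ker l(A) = S(A)`)]
[cite: Deligne1982HodgeCycles, I §3 Prop. 3.4] -/
theorem mem_hodgeClassSpan_of_forall_specialLefschetzGroup_apply_eq (hX : IsSmoothProjective n X) {p : ℕ}
    {x : complexBetti X (2 * p)} (hx : ∀ g ∈ specialLefschetzGroup n X, g (2 * p) x = x) :
    x ∈ hodgeClassSpan n X p :=
  Deligne1982.mem_span_hodgeClasses_of_forall_hodgeGroup_apply_eq hX fun g hg ↦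
    hx g (hodgeGroup_le_specialLefschetzGroup hX hg)

/-- **In odd degree only `0` is `S`-invariant** (Milne p. 657, for a supersingular elliptic curve: "`−1 ∈ μ₂`
acts as multiplication by `(−1)ⁱ` on `Hⁱ(A^r)`. Hence `(H*(A^r))^{S(A)} = ⊕ᵢ H²ⁱ(A^r)`"; here for every
smooth projective `X`, through `Hg ≤ S` and the Hodge operator, the tree's
`Deligne1982.eq_zero_of_forall_hodgeGroup_apply_eq_of_odd`).
[cite: Milne1999LefschetzClasses, §3 p. 657] [cite: Deligne1982HodgeCycles, I §3 Prop. 3.4] -/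
theorem eq_zero_of_forall_specialLefschetzGroup_apply_eq_of_odd (hX : IsSmoothProjective n X) {k : ℕ}
    (hk : Odd k) {x : complexBetti X k} (hx : ∀ g ∈ specialLefschetzGroup n X, g k x = x) : x = 0 :=
  Deligne1982.eq_zero_of_forall_hodgeGroup_apply_eq_of_odd hX hk fun g hg ↦
    hx g (hodgeGroup_le_specialLefschetzGroup hX hg)

/-- **The record in one degree from `Bᵖ ⊆ Dᵖ ⊗ ℂ` in that degree**: if every rational `(p,p)`-class of
`X` lies in `Dᵖ(X) ⊗ ℂ`, then every `S`-invariant class of `H²ᵖ(X(ℂ); ℂ)` lies in `Dᵖ(X) ⊗ ℂ` (the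
conclusion of `Milne1999_specialLefschetzGroup_invariants_le` in degree `2p`): the invariants lie in
`Bᵖ ⊗ ℂ = span` of those classes. [cite: Milne1999LefschetzClasses, Cor. 4.5 (p. 659) and §4 p. 660]
[cite: Deligne1982HodgeCycles, I §3 Prop. 3.4] -/
theorem specialLefschetzGroup_invariants_le_of_hodgeClasses_divisorial (hX : IsSmoothProjective n X) {p : ℕ}
    (hBD : ∀ c : complexBetti X (2 * p), IsRationalClass c → IsOfHodgeType n X (2 * p) p p c →
      c ∈ divisorClassesSpan X n p)
    (x : complexBetti X (2 * p)) (hx : ∀ g ∈ specialLefschetzGroup n X, g (2 * p) x = x) :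
    x ∈ divisorClassesSpan X n p :=
  (Submodule.span_le.2 fun c hc ↦ hBD c hc.1 hc.2)
    (mem_hodgeClassSpan_of_forall_specialLefschetzGroup_apply_eq hX hx)

/-- **The record is a statement about Hodge classes**: in degree `2p`, "every `S`-invariant class lies in
`Dᵖ ⊗ ℂ`" is equivalent to "every `S`-invariant class OF `Bᵖ ⊗ ℂ` lies in `Dᵖ ⊗ ℂ`" — Milne's
Introduction: the Lefschetz classes among the Hodge classes are the ones fixed by the (larger) Lefschetz
group. [cite: Milne1999LefschetzClasses, Introduction (p. 639) and Cor. 4.5 (p. 659)]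
[cite: Deligne1982HodgeCycles, I §3 Prop. 3.4] -/
theorem forall_specialLefschetzGroup_invariants_le_iff_hodgeClassSpan (hX : IsSmoothProjective n X) (p : ℕ) :
    (∀ x : complexBetti X (2 * p), (∀ g ∈ specialLefschetzGroup n X, g (2 * p) x = x) →
        x ∈ divisorClassesSpan X n p) ↔
      ∀ x ∈ hodgeClassSpan n X p, (∀ g ∈ specialLefschetzGroup n X, g (2 * p) x = x) →
        x ∈ divisorClassesSpan X n p :=
  ⟨fun h x _ hx ↦ h x hx,
    fun h x hx ↦ h x (mem_hodgeClassSpan_of_forall_specialLefschetzGroup_apply_eq hX hx) hx⟩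

/-- **The record in the automatic degrees, for every smooth projective complex `n`-fold**: for `p ≤ 1` or
`n ≤ p + 1` (degrees `0`, `2`, `2n − 2`, `2n` and beyond the top), every `S`-invariant class of
`H²ᵖ(X(ℂ); ℂ)` lies in `Dᵖ(X) ⊗ ℂ` (`Bᵖ ⊆ Dᵖ ⊗ ℂ` there: `H⁰ = ℂ · 1`, `B¹ = D¹`, and hard Lefschetz from
the complementary degree — the tree's `hodgeClasses_divisorial_of_le_one_or_le_succ`).
[cite: Milne1999LefschetzClasses, Prop. 3.3 (p. 653) and Cor. 4.5 (p. 659)]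
[cite: MoonenZarhin1999LowDim, Introduction (p. 711)] [cite: VoisinHodgeI2002, Thm. 6.25, Rem. 6.27 and §7.1.2] -/
theorem specialLefschetzGroup_invariants_le_of_le_one_or_le_succ (hX : IsSmoothProjective n X) {p : ℕ}
    (hp : p ≤ 1 ∨ n ≤ p + 1) (x : complexBetti X (2 * p))
    (hx : ∀ g ∈ specialLefschetzGroup n X, g (2 * p) x = x) : x ∈ divisorClassesSpan X n p :=
  specialLefschetzGroup_invariants_le_of_hodgeClasses_divisorial hX
    (hodgeClasses_divisorial_of_le_one_or_le_succ hX hp) x hx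

/-- **The record for every smooth projective complex variety of dimension `≤ 3`**, all degrees (Moonen–Zarhin,
Introduction: "If `dim(X) ≤ 3` then every Hodge class on `X` is a linear combination of products of divisor
classes. (This is true for any smooth projective complex variety `X`.)" — the tree's
`hodgeClasses_divisorial_of_dim_le_three`). [cite: Milne1999LefschetzClasses, Cor. 4.5 (p. 659)]
[cite: MoonenZarhin1999LowDim, Introduction (p. 711)] -/
theorem specialLefschetzGroup_invariants_le_of_le_three (hX : IsSmoothProjective n X) (hn : n ≤ 3) (p : ℕ)
    (x : complexBetti X (2 * p)) (hx : ∀ g ∈ specialLefschetzGroup n X, g (2 * p) x = x) :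
    x ∈ divisorClassesSpan X n p :=
  specialLefschetzGroup_invariants_le_of_hodgeClasses_divisorial hX
    (hodgeClasses_divisorial_of_dim_le_three hX hn p) x hx

/-- **`D¹ ⊗ ℂ = B¹ ⊗ ℂ`** on the carriers (van Geemen §2.4: `D` is the subring generated by `B⁰` and `B¹`;
its degree-one part is `B¹`): the divisor monomials of degree `1` are the classes `1 ∪ b = b` with `b`
rational of type `(1,1)`. [cite: vanGeemen1994HodgeAV, §2.4 (p. 235)] [cite: HatcherAT2002, §3.2 p. 211] -/
theorem divisorClassesSpan_one_eq_hodgeClassSpan_one (N : ℕ) (X : SchemeOver ℂ) :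
    divisorClassesSpan X N 1 = hodgeClassSpan N X 1 := by
  refine le_antisymm (Submodule.span_le.2 ?_) (Submodule.span_le.2 ?_)
  · rintro c ⟨a, ha, b, hb, hb', rfl⟩
    rw [mem_divisorMonomials_zero] at ha
    subst ha
    rw [one_cupProduct b]
    exact Submodule.subset_span ⟨hb, hb'⟩
  · rintro b ⟨hb, hb'⟩
    exact mem_divisorClassesSpan_one hb hb'

end SmoothProjective

/-! ### §2 Abelian varieties: the record on the locus `B(A) = D(A)` -/

section AbelianVariety

variable {A B : AbelianVariety ℂ}

/-- **The `S(A)`-invariants of `H²ᵖ(A(ℂ); ℂ)` are Hodge classes** (`⊆ Bᵖ(A) ⊗ ℂ`), for every complex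
abelian variety. [cite: Milne1999LefschetzClasses, §4 p. 660 (`L(A) ⊃ Hg(A)`) and p. 659]
[cite: Deligne1982HodgeCycles, I §3 Prop. 3.4] -/
theorem mem_hodgeClassSpan_of_forall_specialLefschetzGroup_apply_eq' {p : ℕ} {x : complexBetti A.X (2 * p)}
    (hx : ∀ g ∈ specialLefschetzGroup A.dim A.X, g (2 * p) x = x) : x ∈ hodgeClassSpan A.dim A.X p :=
  mem_hodgeClassSpan_of_forall_specialLefschetzGroup_apply_eq AbelianVariety.isSmoothProjective_holds hx

/-- **The conclusion of the record `Milne1999_specialLefschetzGroup_invariants_le` (Milne 1999, Cor. 4.5 with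
Thm. 4.4 and Thm. 3.2) PROVED for every complex abelian variety whose Hodge ring is generated by divisor
classes** (`IsDivisorGenerated A`: `Bᵖ(A) ⊆ Dᵖ(A) ⊗ ℂ` for all `p`; Milne Prop. 4.8 (a) on `A` itself):
every class `x ∈ H²ᵖ(A(ℂ); ℂ)` fixed by every element of `specialLefschetzGroup (dim A) A.X` lies in
`Dᵖ_hom(A)_ℂ = divisorClassesSpan A.X (dim A) p` — it is a Hodge class (`Hg ≤ S`, Deligne I 3.4), and on
such `A` Hodge classes are Lefschetz. No hypothesis on `End(A)`.
[cite: Milne1999LefschetzClasses, Cor. 4.5 (p. 659), §4 p. 660, Prop. 4.8 (a)]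
[cite: Deligne1982HodgeCycles, I §3 Prop. 3.4] [cite: vanGeemen1994HodgeAV, §2.4–2.5] -/
theorem specialLefschetzGroup_invariants_le_of_isDivisorGenerated (hBD : IsDivisorGenerated A) (p : ℕ)
    (x : complexBetti A.X (2 * p)) (hx : ∀ g ∈ specialLefschetzGroup A.dim A.X, g (2 * p) x = x) :
    x ∈ divisorClassesSpan A.X A.dim p :=
  specialLefschetzGroup_invariants_le_of_hodgeClasses_divisorial AbelianVariety.isSmoothProjective_holds
    (hBD p) x hx

/-- **Cor. 4.5 as an equality of sets, on the locus `B(A) = D(A)`**: the `S(A)`-invariants of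
`H²ᵖ(A(ℂ); ℂ)` are EXACTLY `Dᵖ_hom(A)_ℂ` (the converse inclusion is definitional,
`apply_eq_self_of_mem_specialLefschetzGroup`). [cite: Milne1999LefschetzClasses, Cor. 4.5 (p. 659)] -/
theorem setOf_forall_apply_eq_self_eq_divisorClassesSpan_of_isDivisorGenerated (hBD : IsDivisorGenerated A)
    (p : ℕ) :
    {x : complexBetti A.X (2 * p) | ∀ g ∈ specialLefschetzGroup A.dim A.X, g (2 * p) x = x} =
      (divisorClassesSpan A.X A.dim p : Set _) :=
  Set.Subset.antisymm (fun x hx ↦ specialLefschetzGroup_invariants_le_of_isDivisorGenerated hBD p x hx)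
    fun _ hx _ hg ↦ apply_eq_self_of_mem_specialLefschetzGroup hg hx

/-- **The record in one degree `2p` from `Bᵖ(A) ⊆ Dᵖ(A) ⊗ ℂ` in that degree** (e.g. from a dimension count
`dim_ℚ Bᵖ(A) = dim_ℚ Dᵖ(A)` in the cell's CM atlas). [cite: Milne1999LefschetzClasses, Cor. 4.5 (p. 659) and §4 p. 660]
[cite: Deligne1982HodgeCycles, I §3 Prop. 3.4] -/
theorem specialLefschetzGroup_invariants_le_of_hodgeClassSpan_le {p : ℕ}
    (hBD : hodgeClassSpan A.dim A.X p ≤ divisorClassesSpan A.X A.dim p)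
    (x : complexBetti A.X (2 * p)) (hx : ∀ g ∈ specialLefschetzGroup A.dim A.X, g (2 * p) x = x) :
    x ∈ divisorClassesSpan A.X A.dim p :=
  hBD (mem_hodgeClassSpan_of_forall_specialLefschetzGroup_apply_eq' hx)

/-! #### Prop. 3.3 (`r = 1`): degree `2`, every complex abelian variety -/

/-- **Milne 1999, Prop. 3.3 with `r = 1`, PROVED for every complex abelian variety: "the `k`-vector space
`H²(A^r)^{S(A)}` is generated by divisor classes"** — on the carriers: every class of `H²(A(ℂ); ℂ)` fixed by
every element of `specialLefschetzGroup (dim A) A.X` lies in `D¹_hom(A)_ℂ = divisorClassesSpan A.X (dim A) 1`,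
the `ℂ`-span of the rational `(1,1)`-classes (`= NS(A) ⊗ ℂ` by Lefschetz `(1,1)`). The degree-`1` case of
the record `Milne1999_specialLefschetzGroup_invariants_le`, with no hypothesis on `A`. Road: `Hg ≤ S` and
Deligne I 3.4 give a `ℂ`-combination of rational `(1,1)`-classes, and `B¹ = D¹` (NOT Milne's road
Lemma 3.5 + Prop. 1.3). [cite: Milne1999LefschetzClasses, Prop. 3.3 (p. 653) and Cor. 4.5 (p. 659)]
[cite: Deligne1982HodgeCycles, I §3 Prop. 3.4] -/
theorem specialLefschetzGroup_invariants_le_one (A : AbelianVariety ℂ) (x : complexBetti A.X (2 * 1))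
    (hx : ∀ g ∈ specialLefschetzGroup A.dim A.X, g (2 * 1) x = x) : x ∈ divisorClassesSpan A.X A.dim 1 :=
  specialLefschetzGroup_invariants_le_of_le_one_or_le_succ AbelianVariety.isSmoothProjective_holds
    (Or.inl le_rfl) x hx

/-- **Prop. 3.3 (`r = 1`) as an equality of sets**: the `S(A)`-invariants of `H²(A(ℂ); ℂ)` are EXACTLY
`D¹_hom(A)_ℂ`, for every complex abelian variety. [cite: Milne1999LefschetzClasses, Prop. 3.3 (p. 653) and Cor. 4.5 (p. 659)] -/
theorem setOf_forall_apply_eq_self_two_eq_divisorClassesSpan_one (A : AbelianVariety ℂ) :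
    {x : complexBetti A.X (2 * 1) | ∀ g ∈ specialLefschetzGroup A.dim A.X, g (2 * 1) x = x} =
      (divisorClassesSpan A.X A.dim 1 : Set _) :=
  Set.Subset.antisymm (fun x hx ↦ specialLefschetzGroup_invariants_le_one A x hx)
    fun _ hx _ hg ↦ apply_eq_self_of_mem_specialLefschetzGroup hg hx

/-- **In degree `2` the `S(A)`-invariants and the `Hg(A)`-invariants coincide**: both are
`B¹(A) ⊗ ℂ = D¹(A) ⊗ ℂ` (Prop. 3.3 for `S(A)`; Deligne I 3.4 / Lefschetz `(1,1)` for `Hg(A)`), for every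
complex abelian variety — although `Hg′(A) ≠ S(A)` in general (Prop. 4.8, Remark 4.9).
[cite: Milne1999LefschetzClasses, Prop. 3.3 (p. 653), Prop. 4.8 and Remark 4.9 (p. 660)]
[cite: Deligne1982HodgeCycles, I §3 Prop. 3.4] -/
theorem setOf_forall_apply_eq_self_two_eq_hodgeClassSpan_one (A : AbelianVariety ℂ) :
    {x : complexBetti A.X (2 * 1) | ∀ g ∈ specialLefschetzGroup A.dim A.X, g (2 * 1) x = x} =
      (hodgeClassSpan A.dim A.X 1 : Set _) ∧
    {x : complexBetti A.X (2 * 1) | ∀ g ∈ hodgeGroup A.dim A.X, g (2 * 1) x = x} =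
      (hodgeClassSpan A.dim A.X 1 : Set _) := by
  refine ⟨?_, Set.ext fun x ↦ Deligne1982.forall_hodgeGroup_apply_eq_iff_mem_span_hodgeClasses
    AbelianVariety.isSmoothProjective_holds x⟩
  rw [setOf_forall_apply_eq_self_two_eq_divisorClassesSpan_one, divisorClassesSpan_one_eq_hodgeClassSpan_one]

/-! #### The automatic degrees and low dimension, every complex abelian variety -/

/-- **The record in the degrees `p ≤ 1` and `dim A ≤ p + 1`, for EVERY complex abelian variety** (degrees
`0`, `2`, `2 dim A − 2`, `2 dim A`, and beyond the top where `H²ᵖ = 0`): every `S(A)`-invariant class of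
`H²ᵖ(A(ℂ); ℂ)` lies in `Dᵖ_hom(A)_ℂ`. [cite: Milne1999LefschetzClasses, Prop. 3.3 (p. 653) and Cor. 4.5 (p. 659)]
[cite: MoonenZarhin1999LowDim, Introduction (p. 711)] [cite: VoisinHodgeI2002, Thm. 6.25, Rem. 6.27 and §7.1.2] -/
theorem specialLefschetzGroup_invariants_le_of_le_one_or_dim_le_succ {p : ℕ} (hp : p ≤ 1 ∨ A.dim ≤ p + 1)
    (x : complexBetti A.X (2 * p)) (hx : ∀ g ∈ specialLefschetzGroup A.dim A.X, g (2 * p) x = x) :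
    x ∈ divisorClassesSpan A.X A.dim p :=
  specialLefschetzGroup_invariants_le_of_le_one_or_le_succ AbelianVariety.isSmoothProjective_holds hp x hx

/-- **The conclusion of the record `Milne1999_specialLefschetzGroup_invariants_le` PROVED for every complex
abelian variety of dimension `≤ 3`**, in every degree and for every Albert type of `End⁰(A)` (abelian
surfaces with quaternionic multiplication, `E × E′`, `E³`, simple CM or not): the `S(A)`-invariants of
`H²ᵖ(A(ℂ); ℂ)` are Hodge classes and `B(A) = D(A)` in dimension `≤ 3` (Moonen–Zarhin; the tree's
`isDivisorGenerated_of_dim_le_three`). [cite: Milne1999LefschetzClasses, Thm. 3.2, Cor. 4.5 (p. 659)]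
[cite: MoonenZarhin1999LowDim, Introduction (p. 711)] [cite: Deligne1982HodgeCycles, I §3 Prop. 3.4] -/
theorem specialLefschetzGroup_invariants_le_of_dim_le_three (h3 : A.dim ≤ 3) (p : ℕ)
    (x : complexBetti A.X (2 * p)) (hx : ∀ g ∈ specialLefschetzGroup A.dim A.X, g (2 * p) x = x) :
    x ∈ divisorClassesSpan A.X A.dim p :=
  specialLefschetzGroup_invariants_le_of_isDivisorGenerated (isDivisorGenerated_of_dim_le_three A h3) p x hx

/-- **Cor. 4.5 as an equality of sets for `dim A ≤ 3`.** [cite: Milne1999LefschetzClasses, Cor. 4.5 (p. 659)]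
[cite: MoonenZarhin1999LowDim, Introduction (p. 711)] -/
theorem setOf_forall_apply_eq_self_eq_divisorClassesSpan_of_dim_le_three (h3 : A.dim ≤ 3) (p : ℕ) :
    {x : complexBetti A.X (2 * p) | ∀ g ∈ specialLefschetzGroup A.dim A.X, g (2 * p) x = x} =
      (divisorClassesSpan A.X A.dim p : Set _) :=
  setOf_forall_apply_eq_self_eq_divisorClassesSpan_of_isDivisorGenerated (isDivisorGenerated_of_dim_le_three A h3) p

/-- **For `dim A ≤ 5` the record for `A` follows from `B²(A) ⊆ D²(A) ⊗ ℂ` alone** (the only degree not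
automatic; Moonen–Zarhin decide `B = D` for fourfolds and fivefolds in codimension `2`).
[cite: Milne1999LefschetzClasses, Cor. 4.5 (p. 659)] [cite: MoonenZarhin1999LowDim, Introduction (p. 711) and Thm. 0.1] -/
theorem specialLefschetzGroup_invariants_le_of_dim_le_five_of_codimTwo (h5 : A.dim ≤ 5)
    (h2 : ∀ c : complexBetti A.X (2 * 2), IsRationalClass c → IsOfHodgeType A.dim A.X (2 * 2) 2 2 c →
      c ∈ divisorClassesSpan A.X A.dim 2)
    (p : ℕ) (x : complexBetti A.X (2 * p)) (hx : ∀ g ∈ specialLefschetzGroup A.dim A.X, g (2 * p) x = x) :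
    x ∈ divisorClassesSpan A.X A.dim p :=
  specialLefschetzGroup_invariants_le_of_isDivisorGenerated (isDivisorGenerated_of_dim_le_five_of_codimTwo A h5 h2)
    p x hx

/-- **For `dim A ≤ 7` the record for `A` follows from `B² ⊆ D² ⊗ ℂ` and `B³ ⊆ D³ ⊗ ℂ`.**
[cite: Milne1999LefschetzClasses, Cor. 4.5 (p. 659)] [cite: MoonenZarhin1999LowDim, Introduction (p. 711)] -/
theorem specialLefschetzGroup_invariants_le_of_dim_le_seven_of_codimTwo_three (h7 : A.dim ≤ 7)
    (h2 : ∀ c : complexBetti A.X (2 * 2), IsRationalClass c → IsOfHodgeType A.dim A.X (2 * 2) 2 2 c →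
      c ∈ divisorClassesSpan A.X A.dim 2)
    (h3 : ∀ c : complexBetti A.X (2 * 3), IsRationalClass c → IsOfHodgeType A.dim A.X (2 * 3) 3 3 c →
      c ∈ divisorClassesSpan A.X A.dim 3)
    (p : ℕ) (x : complexBetti A.X (2 * p)) (hx : ∀ g ∈ specialLefschetzGroup A.dim A.X, g (2 * p) x = x) :
    x ∈ divisorClassesSpan A.X A.dim p :=
  specialLefschetzGroup_invariants_le_of_isDivisorGenerated
    (isDivisorGenerated_of_dim_le_seven_of_codimTwo_three A h7 h2 h3) p x hx

/-! #### Products of elliptic curves (van Geemen Thm. 4.3) and the closure of the locus -/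

/-- **The conclusion of the record PROVED for every complex abelian variety isogenous to a product of powers
`E₀^{N₀+1} × ⋯ × E_r^{N_r+1}` of ARBITRARY elliptic curves** (complex multiplication and isogenies among the
`Eᵢ` allowed; `End⁰(A)` is then a product of matrix algebras over `ℚ` or imaginary quadratic fields — in
general NEITHER commutative NOR of CM type): `B(A) = D(A)` by van Geemen's Thm. 4.3 ("For an abelian
variety `X` which is isogeneous to a product of elliptic curves … `Bᵖ(X) = Dᵖ(X)` for all `p`", the tree's
theorem `vanGeemen1994_thm43_isDivisorGenerated`). [cite: Milne1999LefschetzClasses, Thm. 3.2, Cor. 4.5 (p. 659)]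
[cite: vanGeemen1994HodgeAV, Thm. 4.3] [cite: MoonenZarhin1999LowDim, Cor. (3.9)] -/
theorem specialLefschetzGroup_invariants_le_of_isIsogenous_multiPowSucc (r : ℕ)
    (E : Fin (r + 1) → AbelianVariety ℂ) (N : Fin (r + 1) → ℕ) (hE : ∀ i, (E i).dim = 1)
    (hA : A.IsIsogenous (multiPowSucc r E N)) (p : ℕ) (x : complexBetti A.X (2 * p))
    (hx : ∀ g ∈ specialLefschetzGroup A.dim A.X, g (2 * p) x = x) : x ∈ divisorClassesSpan A.X A.dim p :=
  specialLefschetzGroup_invariants_le_of_isDivisorGenerated (vanGeemen1994_thm43_isDivisorGenerated r E N hE hA)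
    p x hx

/-- **The record on the product `E₀^{N₀+1} × ⋯ × E_r^{N_r+1}` itself** (arbitrary elliptic curves `Eᵢ`).
[cite: Milne1999LefschetzClasses, Cor. 4.5 (p. 659)] [cite: vanGeemen1994HodgeAV, Thm. 4.3] -/
theorem specialLefschetzGroup_invariants_le_multiPowSucc (r : ℕ) (E : Fin (r + 1) → AbelianVariety ℂ)
    (N : Fin (r + 1) → ℕ) (hE : ∀ i, (E i).dim = 1) (p : ℕ) (x : complexBetti (multiPowSucc r E N).X (2 * p))
    (hx : ∀ g ∈ specialLefschetzGroup (multiPowSucc r E N).dim (multiPowSucc r E N).X, g (2 * p) x = x) :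
    x ∈ divisorClassesSpan (multiPowSucc r E N).X (multiPowSucc r E N).dim p :=
  specialLefschetzGroup_invariants_le_of_isDivisorGenerated (tate_isDivisorGenerated_multiPowSucc r E N hE) p x hx

/-- **The locus is isogeny-closed**: if `B` is isogenous to `A` and `B(A) = D(A)`, the record holds for `B`
(Milne §1 p. 644: "Clearly `S(A)` depends only on the isogeny class of `A`"; here through the tree's
`IsDivisorGenerated.of_isIsogenous`). [cite: Milne1999LefschetzClasses, §1 p. 644 and Cor. 4.5 (p. 659)]
[cite: vanGeemen1994HodgeAV, §2.4–2.5 and §3.6] -/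
theorem specialLefschetzGroup_invariants_le_of_isIsogenous_of_isDivisorGenerated (hBA : B.IsIsogenous A)
    (hBD : IsDivisorGenerated A) (p : ℕ) (x : complexBetti B.X (2 * p))
    (hx : ∀ g ∈ specialLefschetzGroup B.dim B.X, g (2 * p) x = x) : x ∈ divisorClassesSpan B.X B.dim p :=
  specialLefschetzGroup_invariants_le_of_isDivisorGenerated (hBD.of_isIsogenous hBA) p x hx

/-- **The locus is closed under abelian subvarieties**: for a closed immersion `ι : B ↪ A` that is a
homomorphism and `B(A) = D(A)`, the record holds for `B` (Poincaré reducibility, the tree's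
`IsDivisorGenerated.of_isClosedImmersion`). [cite: Milne1999LefschetzClasses, Cor. 4.5 (p. 659)]
[cite: MumfordAV1970, §19 Thm. 1 (pp. 173–174)] -/
theorem specialLefschetzGroup_invariants_le_of_isClosedImmersion_of_isDivisorGenerated (ι : B ⟶ A)
    [AlgebraicGeometry.IsClosedImmersion (AbelianVariety.Hom.toSchemeHom ι)] (hBD : IsDivisorGenerated A)
    (p : ℕ) (x : complexBetti B.X (2 * p)) (hx : ∀ g ∈ specialLefschetzGroup B.dim B.X, g (2 * p) x = x) :
    x ∈ divisorClassesSpan B.X B.dim p :=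
  specialLefschetzGroup_invariants_le_of_isDivisorGenerated (hBD.of_isClosedImmersion ι) p x hx

/-- **The locus is closed under quotients**: for a surjective homomorphism `q : A ↠ B` and `B(A) = D(A)`,
the record holds for `B` (quasi-sections, the tree's `IsDivisorGenerated.of_surjective_hom`).
[cite: Milne1999LefschetzClasses, Cor. 4.5 (p. 659)] [cite: MumfordAV1970, §19 Thm. 1 and Remark p. 169] -/
theorem specialLefschetzGroup_invariants_le_of_surjective_hom_of_isDivisorGenerated (q : A ⟶ B)
    [AlgebraicGeometry.Surjective (AbelianVariety.Hom.toSchemeHom q)] (hBD : IsDivisorGenerated A)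
    (p : ℕ) (x : complexBetti B.X (2 * p)) (hx : ∀ g ∈ specialLefschetzGroup B.dim B.X, g (2 * p) x = x) :
    x ∈ divisorClassesSpan B.X B.dim p :=
  specialLefschetzGroup_invariants_le_of_isDivisorGenerated (hBD.of_surjective_hom q) p x hx

/-- **The record on the powers from Prop. 4.8 (a)**: if no power of `A` supports an exotic Hodge class
(`∀ a, IsDivisorGenerated (A^{a+1})`), then for every power the `S(A^{a+1})`-invariants of
`H²ᵖ(A^{a+1}(ℂ); ℂ)` are Lefschetz classes — Milne's Cor. 4.5 for all `r ≥ 1` on such `A` (with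
`S(A^r) = S(A)`, Cor. 4.7, read instance-wise on the abelian variety `A^{a+1}`).
[cite: Milne1999LefschetzClasses, Cor. 4.5, Cor. 4.7 and Prop. 4.8 (pp. 659–660)] -/
theorem specialLefschetzGroup_invariants_le_powSucc_of_forall_isDivisorGenerated
    (h : ∀ a, IsDivisorGenerated (A.powSucc a)) (a p : ℕ) (x : complexBetti (A.powSucc a).X (2 * p))
    (hx : ∀ g ∈ specialLefschetzGroup (A.powSucc a).dim (A.powSucc a).X, g (2 * p) x = x) :
    x ∈ divisorClassesSpan (A.powSucc a).X (A.powSucc a).dim p :=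
  specialLefschetzGroup_invariants_le_of_isDivisorGenerated (h a) p x hx

end AbelianVariety

/-! ### §3 The `S(A)(ℂ)`-form read on `H¹`: `unitaryCentralizerGroup A h` and `⋀^{2p}u` -/

section HOne

variable {A : AbelianVariety ℂ} {h : complexBetti A.X 2}

/-- **The classes fixed by `⋀^{2p}u` for all `u ∈ S(A)(ℂ) = unitaryCentralizerGroup A h` are Hodge classes**
(`⊆ Bᵖ(A) ⊗ ℂ`), for ANY `h ∈ B¹(A) ⊗ ℂ` (e.g. a polarization class; no non-degeneracy needed):
`Hg(A)(ℂ)|_{H¹} ≤ S(A)(ℂ)` ("`L(A) ⊃ Hg(A)`" on `H¹`, the tree's `hodgeGroupOne_le_unitaryCentralizerGroup`)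
and a Hodge-group element acts on `H^q(A)` by `⋀^q` of its degree-one component (van Geemen 6.5, the
tree's `hodgeGroup_apply_cupPowOne`), so such a class is fixed by `Hg(A)(ℂ)`; then Deligne I 3.4.
[cite: Milne1999LefschetzClasses, §1 p. 644 (`S(A)`), §4 pp. 659–660] [cite: vanGeemen1994HodgeAV, 6.5–6.7]
[cite: Deligne1982HodgeCycles, I §3 Prop. 3.4] -/
theorem mem_hodgeClassSpan_of_forall_exteriorPullback_eq (hh : h ∈ hodgeClassSpan A.dim A.X 1) {p : ℕ}
    {x : complexBetti A.X (2 * p)}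
    (hx : ∀ u ∈ unitaryCentralizerGroup A h,
      exteriorPullback (AbelianVariety.hasExteriorCohomologyH1_complexPoints A)
        (u : complexBetti A.X 1 →ₗ[ℂ] complexBetti A.X 1) (2 * p) x = x) :
    x ∈ hodgeClassSpan A.dim A.X p := by
  refine Deligne1982.mem_span_hodgeClasses_of_forall_hodgeGroup_apply_eq
    (AbelianVariety.isSmoothProjective_holds (A := A)) fun g hg ↦ ?_
  have hu : g 1 ∈ unitaryCentralizerGroup A h :=
    hodgeGroupOne_le_unitaryCentralizerGroup hh (mem_hodgeGroupOne_iff.2 ⟨g, hg, rfl⟩)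
  -- `g_{2p} = ⋀^{2p} g₁` on the abelian variety `A`
  have key : (g (2 * p) : complexBetti A.X (2 * p) →ₗ[ℂ] complexBetti A.X (2 * p)) =
      exteriorPullback (AbelianVariety.hasExteriorCohomologyH1_complexPoints A)
        (g 1 : complexBetti A.X 1 →ₗ[ℂ] complexBetti A.X 1) (2 * p) := by
    refine exteriorPullback_ext (AbelianVariety.hasExteriorCohomologyH1_complexPoints A) fun v ↦ ?_
    rw [LinearEquiv.coe_coe, hodgeGroup_apply_cupPowOne hg, exteriorPullback_cupPowOne]
    rfl
  have e := hx (g 1) hu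
  rwa [← key, LinearEquiv.coe_coe] at e

/-- **The `S(A)(ℂ)`-form of the record on the locus `B(A) = D(A)`**: for ANY `h ∈ B¹(A) ⊗ ℂ`, every class
of `H²ᵖ(A(ℂ); ℂ)` fixed by `⋀^{2p}u` for all `u ∈ unitaryCentralizerGroup A h` lies in `Dᵖ(A) ⊗ ℂ`.
[cite: Milne1999LefschetzClasses, §1 p. 644, Cor. 4.5 (p. 659), Prop. 4.8 (a)] [cite: Deligne1982HodgeCycles, I §3 Prop. 3.4] -/
theorem mem_divisorClassesSpan_of_forall_exteriorPullback_eq_of_isDivisorGenerated (hBD : IsDivisorGenerated A)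
    (hh : h ∈ hodgeClassSpan A.dim A.X 1) (p : ℕ) (x : complexBetti A.X (2 * p))
    (hx : ∀ u ∈ unitaryCentralizerGroup A h,
      exteriorPullback (AbelianVariety.hasExteriorCohomologyH1_complexPoints A)
        (u : complexBetti A.X 1 →ₗ[ℂ] complexBetti A.X 1) (2 * p) x = x) :
    x ∈ divisorClassesSpan A.X A.dim p :=
  (Submodule.span_le.2 fun c hc ↦ hBD p c hc.1 hc.2) (mem_hodgeClassSpan_of_forall_exteriorPullback_eq hh hx)

/-- **The `S(A)(ℂ)`-form of Prop. 3.3 (`r = 1`)**, every complex abelian variety, any `h ∈ B¹(A) ⊗ ℂ`: a class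
of `H²(A(ℂ); ℂ)` fixed by `⋀²u` for all `u ∈ unitaryCentralizerGroup A h` lies in `D¹(A) ⊗ ℂ`.
[cite: Milne1999LefschetzClasses, Prop. 3.3 (p. 653) and §1 p. 644] [cite: Deligne1982HodgeCycles, I §3 Prop. 3.4] -/
theorem mem_divisorClassesSpan_one_of_forall_exteriorPullback_eq (hh : h ∈ hodgeClassSpan A.dim A.X 1)
    (x : complexBetti A.X (2 * 1))
    (hx : ∀ u ∈ unitaryCentralizerGroup A h,
      exteriorPullback (AbelianVariety.hasExteriorCohomologyH1_complexPoints A)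
        (u : complexBetti A.X 1 →ₗ[ℂ] complexBetti A.X 1) (2 * 1) x = x) :
    x ∈ divisorClassesSpan A.X A.dim 1 := by
  rw [divisorClassesSpan_one_eq_hodgeClassSpan_one]
  exact mem_hodgeClassSpan_of_forall_exteriorPullback_eq hh hx

/-- **The `S(A)(ℂ)`-form in the automatic degrees** `p ≤ 1` or `dim A ≤ p + 1`, every complex abelian
variety, any `h ∈ B¹(A) ⊗ ℂ`. [cite: Milne1999LefschetzClasses, Prop. 3.3 (p. 653) and Cor. 4.5 (p. 659)]
[cite: MoonenZarhin1999LowDim, Introduction (p. 711)] -/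
theorem mem_divisorClassesSpan_of_forall_exteriorPullback_eq_of_le_one_or_dim_le_succ
    (hh : h ∈ hodgeClassSpan A.dim A.X 1) {p : ℕ} (hp : p ≤ 1 ∨ A.dim ≤ p + 1) (x : complexBetti A.X (2 * p))
    (hx : ∀ u ∈ unitaryCentralizerGroup A h,
      exteriorPullback (AbelianVariety.hasExteriorCohomologyH1_complexPoints A)
        (u : complexBetti A.X 1 →ₗ[ℂ] complexBetti A.X 1) (2 * p) x = x) :
    x ∈ divisorClassesSpan A.X A.dim p :=
  (Submodule.span_le.2 fun c hc ↦ hodgeClasses_divisorial_of_le_one_or_le_succ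
      AbelianVariety.isSmoothProjective_holds hp c hc.1 hc.2)
    (mem_hodgeClassSpan_of_forall_exteriorPullback_eq hh hx)

/-- **The `S(A)(ℂ)`-form for `dim A ≤ 3`**, any `h ∈ B¹(A) ⊗ ℂ`. [cite: Milne1999LefschetzClasses, Cor. 4.5 (p. 659)]
[cite: MoonenZarhin1999LowDim, Introduction (p. 711)] -/
theorem mem_divisorClassesSpan_of_forall_exteriorPullback_eq_of_dim_le_three (h3 : A.dim ≤ 3)
    (hh : h ∈ hodgeClassSpan A.dim A.X 1) (p : ℕ) (x : complexBetti A.X (2 * p))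
    (hx : ∀ u ∈ unitaryCentralizerGroup A h,
      exteriorPullback (AbelianVariety.hasExteriorCohomologyH1_complexPoints A)
        (u : complexBetti A.X 1 →ₗ[ℂ] complexBetti A.X 1) (2 * p) x = x) :
    x ∈ divisorClassesSpan A.X A.dim p :=
  mem_divisorClassesSpan_of_forall_exteriorPullback_eq_of_isDivisorGenerated
    (isDivisorGenerated_of_dim_le_three A h3) hh p x hx

/-- **The `S(A)(ℂ)`-form for `A` isogenous to a product of powers of arbitrary elliptic curves**, any
`h ∈ B¹(A) ⊗ ℂ`. [cite: Milne1999LefschetzClasses, Cor. 4.5 (p. 659)] [cite: vanGeemen1994HodgeAV, Thm. 4.3] -/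
theorem mem_divisorClassesSpan_of_forall_exteriorPullback_eq_of_isIsogenous_multiPowSucc (r : ℕ)
    (E : Fin (r + 1) → AbelianVariety ℂ) (N : Fin (r + 1) → ℕ) (hE : ∀ i, (E i).dim = 1)
    (hA : A.IsIsogenous (multiPowSucc r E N)) (hh : h ∈ hodgeClassSpan A.dim A.X 1) (p : ℕ)
    (x : complexBetti A.X (2 * p))
    (hx : ∀ u ∈ unitaryCentralizerGroup A h,
      exteriorPullback (AbelianVariety.hasExteriorCohomologyH1_complexPoints A)
        (u : complexBetti A.X 1 →ₗ[ℂ] complexBetti A.X 1) (2 * p) x = x) :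
    x ∈ divisorClassesSpan A.X A.dim p :=
  mem_divisorClassesSpan_of_forall_exteriorPullback_eq_of_isDivisorGenerated
    (vanGeemen1994_thm43_isDivisorGenerated r E N hE hA) hh p x hx

end HOne

end Literature.AlgebraicGeometry.Milne1999

end
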